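import Summits.Schanuel.Schanuel.Theorems.ZilberEacPuiseuxBranches
import HarnessLib

/-!
# Arbitrary base branches, LX (a): PLACES AT INFINITY IN THE CELL'S CHART, CONSTRUCTED — the
# weighted substitution `x₀ = s^k`, `x₁ = s^M t` and Puiseux at infinity from a Bézout element

HONEST FRAMING.  Cell `pub-schanuel` (Zilber's Exponential-Algebraic Closedness, case ladder;
host summit Schanuel), seat 2, gen 31.  File LIV decided Mantova–Masser's question for polynomial
fibres over an arbitrary monic irreducible plane curve `F(x₀, x₁) = 0` GIVEN a place at infinity
`x₀ = s^{-k}`, `x₁ = Φ(s)s^{-M}` (`Φ` analytic, `Φ(0) ≠ 0`) as a hypothesis.  This file CONSTRUCTS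
such places:
* **`exists_fibreCycle_puiseux_of_bezout`** — file LXXII's Puiseux-at-infinity with the Bézout
  element `A·Q + B·∂_tQ = r(s) ≠ 0` as the hypothesis instead of irreducibility (proof verbatim);
* **`exists_place_of_weightedTopRow`** — for weights `(k, M)`, `k ≥ 1`, and ANY `Q` with
  `Q(s, t) = F(s^k, s^M t)` (an evaluation identity), a root `θ` of the top row of `Q` gives a place
  `x₀ = s^{-ek}`, `x₁ = Φ(s)s^{-eM}`, `Φ(0) = θ`, of `F = 0` (the Bézout element of `F` is
  transported to `Q`, which need not be irreducible);
* `exists_direction_mul` — a good direction for `(k, M)` is one for `(ek, eM)`.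
File LX (b) specialises this to the steepest edge of the Newton polygon at infinity of a MONIC
curve (every monic irreducible `F` of `x₁`-degree `≥ 2` has such a place); with file LIV this
removes the place hypothesis (file LXI).  [folklore (Newton–Puiseux at
infinity), made concrete]; nothing here is specific to Schanuel's conjecture (neither used nor
implied); Mantova–Masser's question (PLMS 2024 §1 p. 5) and EC(3,2) stay OPEN.
-/

noncomputable section

open Filter Topology Polynomial

set_option linter.dupNamespace false

namespace Summit.Schanuel.Schanuel.Theorems

/-! ## Part A. Puiseux at infinity from a Bézout element -/

/-- **Puiseux at infinity, from a Bézout element.**  `Q ∈ ℂ[s][t]` with `A·Q + B·∂_tQ = r(s)`,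
`r ≠ 0`, rows of degree `≤ N`, top row `T ≠ 0`, `θ` a root of `T`: there are `k ≥ 1` and `ψ`
analytic at `0` with `ψ(0) = θ` and `Q(s^{-k}, ψ(s)) = 0` for all small `s ≠ 0`.  (File LXXII's
`exists_fibreCycle_puiseux`, whose only use of irreducibility was the Bézout element; proof
verbatim.) [folklore (Newton–Puiseux)] -/
theorem exists_fibreCycle_puiseux_of_bezout (Q : ℂ[X][X])
    (hbez : ∃ (A B : ℂ[X][X]) (r : ℂ[X]), r ≠ 0 ∧ A * Q + B * derivative Q = Polynomial.C r)
    (N : ℕ) (hN : ∀ j, (Q.coeff j).natDegree ≤ N) (T : ℂ[X]) (hT : ∀ j, T.coeff j = (Q.coeff j).coeff N)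
    (hT0 : T ≠ 0) {θ : ℂ} (hTθ : T.IsRoot θ) :
    ∃ (k : ℕ) (ψ : ℂ → ℂ), 1 ≤ k ∧ AnalyticAt ℂ ψ 0 ∧ ψ 0 = θ ∧
      ∀ᶠ s in 𝓝[≠] (0 : ℂ), (Q.map (Polynomial.evalRingHom (s ^ k)⁻¹)).eval (ψ s) = 0 := by
  classical
  -- the reversed polynomial `Φ(u, y) = u^N Q(1/u, y)` and its value at `u = 0`
  set Φ : ℂ[X][X] := ∑ j ∈ Finset.range (Q.natDegree + 1),
    Polynomial.monomial j (Polynomial.reflect N (Q.coeff j)) with hΦ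
  have hΦeval : ∀ u : ℂ, u ≠ 0 → ∀ y : ℂ,
      (Φ.map (Polynomial.evalRingHom u)).eval y = u ^ N * (Q.map (Polynomial.evalRingHom u⁻¹)).eval y :=
    fun u hu y => eval_revPP Q hN hu y
  have hcoefΦ : ∀ j, Φ.coeff j = if j < Q.natDegree + 1 then Polynomial.reflect N (Q.coeff j) else 0 := by
    intro j
    rw [hΦ, Polynomial.finsetSum_coeff]
    simp only [Polynomial.coeff_monomial, Finset.sum_ite_eq', Finset.mem_range]
  have hΦ0 : Φ.map (Polynomial.evalRingHom 0) = T := by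
    ext j
    rw [Polynomial.coeff_map, hcoefΦ, Polynomial.coe_evalRingHom]
    split_ifs with hj
    · rw [← Polynomial.coeff_zero_eq_eval_zero, Polynomial.coeff_reflect, Polynomial.revAt_zero, hT]
    · rw [Polynomial.eval_zero, hT, Polynomial.coeff_eq_zero_of_natDegree_lt (p := Q) (by omega),
        Polynomial.coeff_zero]
  -- the re-centred polynomial `Ψ(u, v) = Φ(u, θ + v)` and the multiplicity of `θ`
  obtain ⟨hlow, htop⟩ := recentre_facts hΦ0 hT0 θ
  set m := Polynomial.rootMultiplicity θ T with hm
  have hm1 : 1 ≤ m := (Polynomial.rootMultiplicity_pos hT0).2 hTθ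
  -- the Bézout element, reversed
  obtain ⟨A, B, r, hr, hAB⟩ := hbez
  set a : ℕ := max (max ((Finset.range (A.natDegree + 1)).sup fun j => (A.coeff j).natDegree)
    ((Finset.range (B.natDegree + 1)).sup fun j => (B.coeff j).natDegree)) r.natDegree with ha
  have haA : ∀ j, (A.coeff j).natDegree ≤ a := by
    intro j
    by_cases hj : j < A.natDegree + 1
    · exact (Finset.le_sup (f := fun j => (A.coeff j).natDegree) (Finset.mem_range.2 hj)).trans
        ((le_max_left _ _).trans (le_max_left _ _))
    · rw [Polynomial.coeff_eq_zero_of_natDegree_lt (by omega), Polynomial.natDegree_zero]; exact Nat.zero_le _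
  have haB : ∀ j, (B.coeff j).natDegree ≤ a := by
    intro j
    by_cases hj : j < B.natDegree + 1
    · exact (Finset.le_sup (f := fun j => (B.coeff j).natDegree) (Finset.mem_range.2 hj)).trans
        ((le_max_right _ _).trans (le_max_left _ _))
    · rw [Polynomial.coeff_eq_zero_of_natDegree_lt (by omega), Polynomial.natDegree_zero]; exact Nat.zero_le _
  have har : r.natDegree ≤ a + N := (le_max_right _ _).trans (Nat.le_add_right _ _)
  set At : ℂ[X][X] := ∑ j ∈ Finset.range (A.natDegree + 1), Polynomial.monomial j (Polynomial.reflect a (A.coeff j))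
    with hAt
  set Bt : ℂ[X][X] := ∑ j ∈ Finset.range (B.natDegree + 1), Polynomial.monomial j (Polynomial.reflect a (B.coeff j))
    with hBt
  set rt : ℂ[X] := Polynomial.reflect (a + N) r with hrt
  have hrt0 : rt ≠ 0 := by
    rw [hrt, Ne, Polynomial.reflect_eq_zero_iff]; exact hr
  -- `∂_v Φ (u, v) = u^N ∂_tQ(1/u, v)` for `u ≠ 0`
  have hΦ'eval : ∀ u : ℂ, u ≠ 0 → ∀ y : ℂ, ((derivative Φ).map (Polynomial.evalRingHom u)).eval y =
      u ^ N * ((derivative Q).map (Polynomial.evalRingHom u⁻¹)).eval y := by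
    intro u hu y
    have hP : Φ.map (Polynomial.evalRingHom u) = Polynomial.C (u ^ N) * Q.map (Polynomial.evalRingHom u⁻¹) := by
      refine Polynomial.funext fun y' => ?_
      rw [Polynomial.eval_mul, Polynomial.eval_C]; exact hΦeval u hu y'
    have h := congrArg (fun P : ℂ[X] => (derivative P).eval y) hP
    simp only [Polynomial.derivative_map, Polynomial.derivative_mul, Polynomial.derivative_C, zero_mul, zero_add,
      Polynomial.eval_mul, Polynomial.eval_C] at h
    exact h
  have hbezΦ : At * Φ + Bt * derivative Φ = Polynomial.C rt := by
    refine polyPoly_eq_of_eval_eq_of_ne_zero fun u y hu => ?_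
    rw [Polynomial.map_add, Polynomial.map_mul, Polynomial.map_mul, Polynomial.eval_add, Polynomial.eval_mul,
      Polynomial.eval_mul, eval_revPP A haA hu, eval_revPP B haB hu, hΦeval u hu, hΦ'eval u hu, evalPP_C]
    have hb := congrArg (fun P : ℂ[X][X] => (P.map (Polynomial.evalRingHom u⁻¹)).eval y) hAB
    simp only [Polynomial.map_add, Polynomial.map_mul, Polynomial.eval_add, Polynomial.eval_mul, evalPP_C] at hb
    -- `rt(u) = u^{a+N} r(1/u)`
    haveI := invertibleOfNonzero (inv_ne_zero hu)
    have hrev := Polynomial.eval₂_reflect_mul_pow (RingHom.id ℂ) u⁻¹ (a + N) r har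
    rw [invOf_eq_inv, inv_inv] at hrev
    change rt.eval u * u⁻¹ ^ (a + N) = r.eval u⁻¹ at hrev
    have hrt' : rt.eval u = u ^ (a + N) * r.eval u⁻¹ := by
      rw [← hrev, show u ^ (a + N) * (rt.eval u * u⁻¹ ^ (a + N)) = rt.eval u * (u * u⁻¹) ^ (a + N) by ring,
        mul_inv_cancel₀ hu, one_pow, mul_one]
    rw [hrt', ← hb, pow_add]
    ring
  have hbezΨ := bezout_comp_X_add_C hbezΦ (Polynomial.C θ)
  -- Newton–Puiseux for `Ψ`
  obtain ⟨e, η, he, hηan, hη0, hroot⟩ :=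
    exists_puiseux_zeroBranch_of_bezout m (Φ.comp (Polynomial.X + Polynomial.C (Polynomial.C θ))) hm1 hlow htop
      ⟨_, _, rt, hrt0, hbezΨ⟩
  refine ⟨e, fun s => η s + θ, he, hηan.add analyticAt_const, by simp [hη0], ?_⟩
  filter_upwards [self_mem_nhdsWithin, nhdsWithin_le_nhds hroot] with s (hs : s ≠ 0) hΨ
  rw [evalPP_comp_X_add_C, Polynomial.eval_C, hΦeval _ (pow_ne_zero _ hs)] at hΨ
  exact (mul_eq_zero.1 hΨ).resolve_left (pow_ne_zero _ (pow_ne_zero _ hs))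

/-! ## Part B. The weighted substitution `x₀ = s^k`, `x₁ = s^M t` -/

/-- Evaluation of the weighted substitution `W = (F.map (expand k)).comp (s^M · t)`:
`W(s, t) = F(s^k, s^M t)`. [folklore] -/
theorem eval_weightedSubst (F : ℂ[X][X]) (k M : ℕ) (s t : ℂ) :
    (((F.map (Polynomial.expand ℂ k : ℂ[X] →ₐ[ℂ] ℂ[X]).toRingHom).comp
        (Polynomial.C (X ^ M : ℂ[X]) * X)).map (Polynomial.evalRingHom s)).eval t =
      (F.map (Polynomial.evalRingHom (s ^ k))).eval (s ^ M * t) := by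
  rw [Polynomial.map_comp, Polynomial.eval_comp, Polynomial.map_map]
  have hφ : (Polynomial.evalRingHom s).comp (Polynomial.expand ℂ k : ℂ[X] →ₐ[ℂ] ℂ[X]).toRingHom =
      Polynomial.evalRingHom (s ^ k) := by
    refine RingHom.ext fun q => ?_
    simp [Polynomial.expand_eval]
  rw [hφ]
  simp

/-- The derivative of the weighted substitution: `∂_t F(s^k, s^M t) = s^M (∂_{x₁}F)(s^k, s^M t)`.
[folklore] -/
theorem derivative_weightedSubst (F : ℂ[X][X]) (k M : ℕ) :
    derivative ((F.map (Polynomial.expand ℂ k : ℂ[X] →ₐ[ℂ] ℂ[X]).toRingHom).comp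
        (Polynomial.C (X ^ M : ℂ[X]) * X)) =
      ((derivative F).map (Polynomial.expand ℂ k : ℂ[X] →ₐ[ℂ] ℂ[X]).toRingHom).comp
        (Polynomial.C (X ^ M : ℂ[X]) * X) * Polynomial.C (X ^ M : ℂ[X]) := by
  rw [Polynomial.derivative_comp, Polynomial.derivative_map, Polynomial.derivative_C_mul_X, mul_comm]

/-- **Bézout elements survive the weighted substitution**: from `A·F + B·∂F = r(x₀)` one gets
`(s^M·W A)·W F + W B·∂_t(W F) = s^M r(s^k)`. [folklore] -/
theorem bezout_weightedSubst {F A B : ℂ[X][X]} {r : ℂ[X]}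
    (hbez : A * F + B * derivative F = Polynomial.C r) (k M : ℕ) :
    (Polynomial.C (X ^ M : ℂ[X]) *
        (A.map (Polynomial.expand ℂ k : ℂ[X] →ₐ[ℂ] ℂ[X]).toRingHom).comp (Polynomial.C (X ^ M : ℂ[X]) * X)) *
        (F.map (Polynomial.expand ℂ k : ℂ[X] →ₐ[ℂ] ℂ[X]).toRingHom).comp (Polynomial.C (X ^ M : ℂ[X]) * X) +
      (B.map (Polynomial.expand ℂ k : ℂ[X] →ₐ[ℂ] ℂ[X]).toRingHom).comp (Polynomial.C (X ^ M : ℂ[X]) * X) *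
        derivative ((F.map (Polynomial.expand ℂ k : ℂ[X] →ₐ[ℂ] ℂ[X]).toRingHom).comp
          (Polynomial.C (X ^ M : ℂ[X]) * X)) =
      Polynomial.C (X ^ M * Polynomial.expand ℂ k r) := by
  have h := congrArg (fun P : ℂ[X][X] =>
    (P.map (Polynomial.expand ℂ k : ℂ[X] →ₐ[ℂ] ℂ[X]).toRingHom).comp (Polynomial.C (X ^ M : ℂ[X]) * X)) hbez
  simp only [Polynomial.map_add, Polynomial.map_mul, Polynomial.add_comp, Polynomial.mul_comp,
    Polynomial.map_C, Polynomial.C_comp] at h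
  rw [derivative_weightedSubst, map_mul,
    show (Polynomial.C ((Polynomial.expand ℂ k) r) : ℂ[X][X]) =
      Polynomial.C ((Polynomial.expand ℂ k : ℂ[X] →ₐ[ℂ] ℂ[X]).toRingHom r) from rfl, ← h]
  ring

/-- `s^M r(s^k) ≠ 0` for `r ≠ 0`, `k ≥ 1`. [folklore] -/
theorem X_pow_mul_expand_ne_zero {r : ℂ[X]} (hr : r ≠ 0) {k : ℕ} (hk : 1 ≤ k) (M : ℕ) :
    (X ^ M * Polynomial.expand ℂ k r : ℂ[X]) ≠ 0 := by
  refine mul_ne_zero (pow_ne_zero _ Polynomial.X_ne_zero) ?_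
  rwa [Ne, Polynomial.expand_eq_zero (by omega : 0 < k)]

/-- The rows of the weighted substitution: `(W F)_j = f_j(s^k) s^{Mj}`. [folklore] -/
theorem coeff_weightedSubst (F : ℂ[X][X]) (k M j : ℕ) :
    ((F.map (Polynomial.expand ℂ k : ℂ[X] →ₐ[ℂ] ℂ[X]).toRingHom).comp
        (Polynomial.C (X ^ M : ℂ[X]) * X)).coeff j =
      Polynomial.expand ℂ k (F.coeff j) * X ^ (M * j) := by
  classical
  set P : ℂ[X][X] := F.map (Polynomial.expand ℂ k : ℂ[X] →ₐ[ℂ] ℂ[X]).toRingHom with hP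
  have hPc : ∀ i, P.coeff i = Polynomial.expand ℂ k (F.coeff i) := by
    intro i; rw [hP, Polynomial.coeff_map]; rfl
  rw [Polynomial.comp, Polynomial.eval₂_eq_sum_range, Polynomial.finsetSum_coeff]
  have hterm : ∀ i, (Polynomial.C (P.coeff i) * (Polynomial.C (X ^ M : ℂ[X]) * X) ^ i).coeff j =
      if i = j then Polynomial.expand ℂ k (F.coeff j) * X ^ (M * j) else 0 := by
    intro i
    rw [mul_pow, ← Polynomial.C_pow, ← mul_assoc, ← Polynomial.C_mul, Polynomial.coeff_C_mul_X_pow]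
    split_ifs with h1 h2 h2
    · subst h2; rw [hPc, pow_mul]
    · exact absurd h1.symm h2
    · exact absurd h2.symm h1
    · rfl
  simp only [hterm, Finset.sum_ite_eq', Finset.mem_range]
  split_ifs with hj
  · rfl
  · have : P.coeff j = 0 := Polynomial.coeff_eq_zero_of_natDegree_lt (by omega)
    rw [← hPc, this, zero_mul]

/-! ## Part C. A place at infinity from a root of a weighted top row -/

/-- **A place at infinity in the cell's chart from a weighted top-row root.**  `F ∈ ℂ[x₀][x₁]` with
a Bézout element `A·F + B·∂_{x₁}F = r(x₀) ≠ 0` (e.g. `F` irreducible of positive `x₁`-degree);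
weights `(k, M)`, `k ≥ 1`; ANY `Q ∈ ℂ[s][t]` with `Q(s, t) = F(s^k, s^M t)`; rows of `Q` of degree
`≤ N`, top row `T ≠ 0` (`T_j = ` coefficient of `s^N` in `Q_j`), `θ` a root of `T`.  Then there are
`e ≥ 1` and `Φ` analytic at `0` with `Φ(0) = θ` and `F(s^{-ek}, Φ(s)s^{-eM}) = 0` for all small
`s ≠ 0`.  (`Q` equals the weighted substitution of Part B, so `F`'s Bézout element transports to
`Q`; then Part A.) [folklore (Newton–Puiseux at infinity)] (new in this form) -/
theorem exists_place_of_weightedTopRow (F : ℂ[X][X])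
    (hbez : ∃ (A B : ℂ[X][X]) (r : ℂ[X]), r ≠ 0 ∧ A * F + B * derivative F = Polynomial.C r)
    {k : ℕ} (hk : 1 ≤ k) (M : ℕ) (Q : ℂ[X][X])
    (hQ : ∀ s t : ℂ, (Q.map (Polynomial.evalRingHom s)).eval t =
      (F.map (Polynomial.evalRingHom (s ^ k))).eval (s ^ M * t))
    (N : ℕ) (hN : ∀ j, (Q.coeff j).natDegree ≤ N) (T : ℂ[X]) (hT : ∀ j, T.coeff j = (Q.coeff j).coeff N)
    (hT0 : T ≠ 0) {θ : ℂ} (hTθ : T.IsRoot θ) :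
    ∃ (e : ℕ) (Φ : ℂ → ℂ), 1 ≤ e ∧ AnalyticAt ℂ Φ 0 ∧ Φ 0 = θ ∧
      ∀ᶠ s in 𝓝[≠] (0 : ℂ),
        (F.map (Polynomial.evalRingHom (s ^ (e * k))⁻¹)).eval (Φ s * (s ^ (e * M))⁻¹) = 0 := by
  obtain ⟨A, B, r, hr, hAB⟩ := hbez
  set W : ℂ[X][X] := (F.map (Polynomial.expand ℂ k : ℂ[X] →ₐ[ℂ] ℂ[X]).toRingHom).comp
    (Polynomial.C (X ^ M : ℂ[X]) * X) with hW
  have hQW : Q = W := polyPoly_eq_of_eval_eq_of_ne_zero fun s t _ => by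
    rw [hQ, hW, eval_weightedSubst]
  have hbezQ : ∃ (A' B' : ℂ[X][X]) (r' : ℂ[X]), r' ≠ 0 ∧ A' * Q + B' * derivative Q = Polynomial.C r' := by
    refine ⟨Polynomial.C (X ^ M : ℂ[X]) *
        (A.map (Polynomial.expand ℂ k : ℂ[X] →ₐ[ℂ] ℂ[X]).toRingHom).comp (Polynomial.C (X ^ M : ℂ[X]) * X),
      (B.map (Polynomial.expand ℂ k : ℂ[X] →ₐ[ℂ] ℂ[X]).toRingHom).comp (Polynomial.C (X ^ M : ℂ[X]) * X),
      X ^ M * Polynomial.expand ℂ k r, X_pow_mul_expand_ne_zero hr hk M, ?_⟩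
    rw [hQW, hW]
    exact bezout_weightedSubst hAB k M
  obtain ⟨e, ψ, he, hψan, hψ0, hroot⟩ := exists_fibreCycle_puiseux_of_bezout Q hbezQ N hN T hT hT0 hTθ
  refine ⟨e, ψ, he, hψan, hψ0, ?_⟩
  filter_upwards [hroot] with s hs
  have h1 : ((s ^ e)⁻¹) ^ k = (s ^ (e * k))⁻¹ := by rw [pow_mul, inv_pow]
  have h2 : ((s ^ e)⁻¹) ^ M = (s ^ (e * M))⁻¹ := by rw [pow_mul, inv_pow]
  rw [hQ, h1, h2, mul_comm] at hs
  exact hs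

/-- A good direction for the exponents `(k, M)` is a good direction for `(ek, eM)`, `e ≥ 1`.
[folklore] -/
theorem exists_direction_mul {k M : ℕ} {a : ℂ} {e : ℕ} (he : 1 ≤ e)
    (hdir : ∃ z : ℂ, z ^ k = 2 * Real.pi * Complex.I ∧ (a * z ^ M).re ≠ 0) :
    ∃ z : ℂ, z ^ (e * k) = 2 * Real.pi * Complex.I ∧ (a * z ^ (e * M)).re ≠ 0 := by
  obtain ⟨z, hz, hre⟩ := hdir
  obtain ⟨w, hw⟩ := IsAlgClosed.exists_pow_nat_eq z (by omega : 0 < e)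
  refine ⟨w, ?_, ?_⟩
  · rw [pow_mul, hw, hz]
  · rw [pow_mul, hw]; exact hre

end Summit.Schanuel.Schanuel.Theorems

end
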